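import Mathlib.LinearAlgebra.BilinearForm.Orthogonal
import Mathlib.LinearAlgebra.FiniteDimensional.Lemmas
import HarnessLib

/-!
# Cell `bsd-monsky`: AOKI = MONSKY, THE ODD CLASSES — part 2, three restriction lemmas for a symmetric bilinear
# form (how the radical changes on a hyperplane) (pure linear algebra over a field; nothing arithmetic asserted)

HONEST FRAMING (cell `bsd-monsky`, run/shared/lean/pub/bsd-monsky/, README §1). This file asserts NO arithmetic
fact. In the odd half of «Aoki 1999 Thm 2.2 = Monsky's matrix count» (HOME/proof/PROOF-B-AOKI-MONSKY.md §5) Aoki's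
essential space for `n ≡ 3, 7 (mod 8)` is the space `W₀` of the odd kernel count (`…OddAokiMonskyKernel.lean`) cut
down by one or two hyperplanes (`t ⬝ w = 0`, and `ε ⬝ w = 0` for `n ≡ 7`), and `t ⬝ · = B(𝟙, ·)` on `W₀` for the
Gram form `B`. The rank of `B` restricted to a subspace `N` is `dim N − dim rad N`, `rad N = N ∩ N^⊥`; this file
computes `rad` and `dim` of `N ∩ ker φ` in the three cases that occur:

* `finrank_inf_ker_add_one` — a functional not vanishing on `N` cuts a hyperplane: `dim (N ∩ ker φ) + 1 = dim N`;
* R1 `rad_inf_ker_of_mem_rad` — `φ(z₀) ≠ 0` for some `z₀ ∈ rad N` (φ «not representable»):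
  `rad (N ∩ ker φ) = rad N ∩ ker φ` (so the rank of `B` is unchanged);
* R2 `rad_inf_ker_of_apply_self_ne_zero` — `φ = B(z, ·)`, `z ∈ N`, `B(z, z) ≠ 0`: `rad (N ∩ ker φ) = rad N`
  (the rank drops by exactly `1`);
* R3 `rad_inf_ker_of_apply_self_eq_zero` — `φ = B(z, ·)`, `z ∈ N ∖ N^⊥`, `B(z, z) = 0`:
  `rad (N ∩ ker φ) = rad N + Kz` with `z ∉ rad N` (the rank drops by exactly `2`).

References: [Aoki1999] Thm. 2.2 p. 81 (the shape `rank ᵗΦ G Φ`) — otherwise [folklore] linear algebra.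
-/

set_option autoImplicit false

namespace Summit.BirchSwinnertonDyer.Rank1Residual.P2.AokiMonsky

open LinearMap (BilinForm)

section Restrict

variable {K V : Type*} [Field K] [AddCommGroup V] [Module K V]

/-- **A functional that does not vanish on `N` cuts out a hyperplane: `dim (N ∩ ker φ) + 1 = dim N`.** [folklore] -/
theorem finrank_inf_ker_add_one [FiniteDimensional K V] (N : Submodule K V) (φ : V →ₗ[K] K) {n₀ : V}
    (hn₀ : n₀ ∈ N) (hφ : φ n₀ ≠ 0) :
    Module.finrank K ↥(N ⊓ LinearMap.ker φ) + 1 = Module.finrank K N := by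
  have hrn := LinearMap.finrank_range_add_finrank_ker (φ ∘ₗ N.subtype)
  have hsurj : LinearMap.range (φ ∘ₗ N.subtype) = ⊤ := by
    rw [LinearMap.range_eq_top]
    intro c
    refine ⟨⟨(c / φ n₀) • n₀, N.smul_mem _ hn₀⟩, ?_⟩
    simp only [LinearMap.coe_comp, Function.comp_apply, Submodule.coe_subtype, map_smul, smul_eq_mul]
    exact div_mul_cancel₀ c hφ
  rw [hsurj, finrank_top, Module.finrank_self, LinearMap.ker_comp] at hrn
  have heq : Submodule.comap N.subtype (LinearMap.ker φ) =
      Submodule.comap N.subtype (N ⊓ LinearMap.ker φ) := by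
    rw [Submodule.comap_inf, Submodule.comap_subtype_self, top_inf_eq]
  rw [heq, (Submodule.comapSubtypeEquivOfLe (inf_le_left : N ⊓ LinearMap.ker φ ≤ N)).finrank_eq] at hrn
  omega

variable (B : BilinForm K V)

/-- The radical `N ∩ N^⊥` is contained in `N ∩ ker B(z, ·)` for `z ∈ N`. [folklore] -/
theorem rad_le_inf_ker (N : Submodule K V) {z : V} (hz : z ∈ N) :
    N ⊓ B.orthogonal N ≤ N ⊓ LinearMap.ker (B z) := by
  intro r hr
  obtain ⟨hrN, hr'⟩ := Submodule.mem_inf.mp hr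
  refine Submodule.mem_inf.mpr ⟨hrN, ?_⟩
  rw [LinearMap.mem_ker]
  exact (B.mem_orthogonal_iff.mp hr') z hz

/-- The radical of `N` is orthogonal to every subspace of `N`. [folklore] -/
theorem rad_le_orthogonal_of_le (N H : Submodule K V) (hHN : H ≤ N) :
    N ⊓ B.orthogonal N ≤ B.orthogonal H := by
  intro r hr
  obtain ⟨-, hr'⟩ := Submodule.mem_inf.mp hr
  exact B.mem_orthogonal_iff.mpr fun n hn => (B.mem_orthogonal_iff.mp hr') n (hHN hn)

/-- **R1 (a non-representable functional does not change the rank).** If `φ(z₀) ≠ 0` for some `z₀` in the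
radical `N ∩ N^⊥` of a symmetric form `B` on `N`, then the radical of `N ∩ ker φ` is `(N ∩ N^⊥) ∩ ker φ`.
[folklore] -/
theorem rad_inf_ker_of_mem_rad (hB : B.IsSymm) (N : Submodule K V) (φ : V →ₗ[K] K) {z₀ : V}
    (hz₀ : z₀ ∈ N ⊓ B.orthogonal N) (hφ : φ z₀ ≠ 0) :
    (N ⊓ LinearMap.ker φ) ⊓ B.orthogonal (N ⊓ LinearMap.ker φ) =
      (N ⊓ B.orthogonal N) ⊓ LinearMap.ker φ := by
  obtain ⟨hz₀N, hz₀'⟩ := Submodule.mem_inf.mp hz₀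
  apply le_antisymm
  · intro h hh
    obtain ⟨hhH, hh'⟩ := Submodule.mem_inf.mp hh
    obtain ⟨hhN, hhφ⟩ := Submodule.mem_inf.mp hhH
    refine Submodule.mem_inf.mpr ⟨Submodule.mem_inf.mpr ⟨hhN, ?_⟩, hhφ⟩
    rw [B.mem_orthogonal_iff]
    intro n hn
    -- `n = (n − c z₀) + c z₀` with `n − c z₀ ∈ N ∩ ker φ`
    have hmem : n - (φ n / φ z₀) • z₀ ∈ N ⊓ LinearMap.ker φ := by
      refine Submodule.mem_inf.mpr ⟨N.sub_mem hn (N.smul_mem _ hz₀N), ?_⟩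
      rw [LinearMap.mem_ker, map_sub, map_smul, smul_eq_mul, div_mul_cancel₀ _ hφ, sub_self]
    have h1 : B (n - (φ n / φ z₀) • z₀) h = 0 := (B.mem_orthogonal_iff.mp hh') _ hmem
    have h2 : B z₀ h = 0 := by
      rw [← hB.eq]
      exact (B.mem_orthogonal_iff.mp hz₀') h hhN
    have h3 : B n h = B (n - (φ n / φ z₀) • z₀) h + (φ n / φ z₀) * B z₀ h := by
      rw [map_sub, LinearMap.sub_apply, map_smul, LinearMap.smul_apply, smul_eq_mul]; ring
    rw [h3, h1, h2, mul_zero, add_zero]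
  · intro r hr
    obtain ⟨hr', hrφ⟩ := Submodule.mem_inf.mp hr
    obtain ⟨hrN, -⟩ := Submodule.mem_inf.mp hr'
    exact Submodule.mem_inf.mpr ⟨Submodule.mem_inf.mpr ⟨hrN, hrφ⟩,
      rad_le_orthogonal_of_le B N _ inf_le_left hr'⟩

/-- **R2 (a representable anisotropic functional drops the rank by one).** For `z ∈ N` with `B(z, z) ≠ 0`,
the radical of `N ∩ ker B(z, ·)` equals the radical of `N` (while the dimension drops by one,
`finrank_inf_ker_add_one`). [folklore] -/
theorem rad_inf_ker_of_apply_self_ne_zero (N : Submodule K V) {z : V} (hz : z ∈ N)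
    (hzz : B z z ≠ 0) :
    (N ⊓ LinearMap.ker (B z)) ⊓ B.orthogonal (N ⊓ LinearMap.ker (B z)) = N ⊓ B.orthogonal N := by
  apply le_antisymm
  · intro h hh
    obtain ⟨hhH, hh'⟩ := Submodule.mem_inf.mp hh
    obtain ⟨hhN, hhz⟩ := Submodule.mem_inf.mp hhH
    refine Submodule.mem_inf.mpr ⟨hhN, ?_⟩
    rw [B.mem_orthogonal_iff]
    intro n hn
    have hmem : n - (B z n / B z z) • z ∈ N ⊓ LinearMap.ker (B z) := by
      refine Submodule.mem_inf.mpr ⟨N.sub_mem hn (N.smul_mem _ hz), ?_⟩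
      rw [LinearMap.mem_ker, map_sub, map_smul, smul_eq_mul, div_mul_cancel₀ _ hzz, sub_self]
    have h1 : B (n - (B z n / B z z) • z) h = 0 := (B.mem_orthogonal_iff.mp hh') _ hmem
    have h2 : B z h = 0 := LinearMap.mem_ker.mp hhz
    have h3 : B n h = B (n - (B z n / B z z) • z) h + (B z n / B z z) * B z h := by
      rw [map_sub, LinearMap.sub_apply, map_smul, LinearMap.smul_apply, smul_eq_mul]; ring
    rw [h3, h1, h2, mul_zero, add_zero]
  · intro r hr
    exact Submodule.mem_inf.mpr ⟨rad_le_inf_ker B N hz hr, rad_le_orthogonal_of_le B N _ inf_le_left hr⟩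

/-- **R3 (a representable isotropic functional drops the rank by two).** For `z ∈ N`, `z ∉ N^⊥`, `B(z, z) = 0`
(`B` symmetric), the radical of `N ∩ ker B(z, ·)` is `(N ∩ N^⊥) + Kz` (and `z ∉ N ∩ N^⊥`). [folklore] -/
theorem rad_inf_ker_of_apply_self_eq_zero (hB : B.IsSymm) (N : Submodule K V) {z : V} (hz : z ∈ N)
    (hzN : z ∉ B.orthogonal N) (hzz : B z z = 0) :
    (N ⊓ LinearMap.ker (B z)) ⊓ B.orthogonal (N ⊓ LinearMap.ker (B z)) = (N ⊓ B.orthogonal N) ⊔ K ∙ z := by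
  -- a witness `n₀ ∈ N` with `B z n₀ ≠ 0`
  have hn₀ : ∃ n₀ ∈ N, B z n₀ ≠ 0 := by
    by_contra h
    simp only [not_exists, not_and, not_not] at h
    exact hzN (B.mem_orthogonal_iff.mpr fun n hn => by rw [hB.eq]; exact h n hn)
  obtain ⟨n₀, hn₀N, hn₀⟩ := hn₀
  have hzH : z ∈ N ⊓ LinearMap.ker (B z) := Submodule.mem_inf.mpr ⟨hz, LinearMap.mem_ker.mpr hzz⟩
  have hzorth : z ∈ B.orthogonal (N ⊓ LinearMap.ker (B z)) := by
    refine B.mem_orthogonal_iff.mpr fun n hn => ?_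
    obtain ⟨-, hnz⟩ := Submodule.mem_inf.mp hn
    rw [hB.eq]
    exact LinearMap.mem_ker.mp hnz
  apply le_antisymm
  · intro h hh
    obtain ⟨hhH, hh'⟩ := Submodule.mem_inf.mp hh
    -- any `h'` in the radical of `N ∩ ker B(z, ·)` with `B n₀ h' = 0` lies in `rad N`
    have key : ∀ h' : V, h' ∈ N ⊓ LinearMap.ker (B z) → h' ∈ B.orthogonal (N ⊓ LinearMap.ker (B z)) →
        B n₀ h' = 0 → h' ∈ N ⊓ B.orthogonal N := by
      intro h' hh'H hh'' h0
      obtain ⟨hh'N, -⟩ := Submodule.mem_inf.mp hh'H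
      refine Submodule.mem_inf.mpr ⟨hh'N, B.mem_orthogonal_iff.mpr fun n hn => ?_⟩
      have hmem : n - (B z n / B z n₀) • n₀ ∈ N ⊓ LinearMap.ker (B z) := by
        refine Submodule.mem_inf.mpr ⟨N.sub_mem hn (N.smul_mem _ hn₀N), ?_⟩
        rw [LinearMap.mem_ker, map_sub, map_smul, smul_eq_mul, div_mul_cancel₀ _ hn₀, sub_self]
      have h1 : B (n - (B z n / B z n₀) • n₀) h' = 0 := (B.mem_orthogonal_iff.mp hh'') _ hmem
      have h3 : B n h' = B (n - (B z n / B z n₀) • n₀) h' + (B z n / B z n₀) * B n₀ h' := by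
        rw [map_sub, LinearMap.sub_apply, map_smul, LinearMap.smul_apply, smul_eq_mul]; ring
      rw [h3, h1, h0, mul_zero, add_zero]
    have hBn₀z : B n₀ z ≠ 0 := by rw [hB.eq]; exact hn₀
    have hh2 : h - (B n₀ h / B n₀ z) • z ∈ N ⊓ B.orthogonal N := by
      refine key _ (Submodule.sub_mem _ hhH (Submodule.smul_mem _ _ hzH))
        (Submodule.sub_mem _ hh' (Submodule.smul_mem _ _ hzorth)) ?_
      rw [map_sub, map_smul, smul_eq_mul, div_mul_cancel₀ _ hBn₀z, sub_self]
    rw [Submodule.mem_sup]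
    exact ⟨h - (B n₀ h / B n₀ z) • z, hh2, (B n₀ h / B n₀ z) • z,
      Submodule.mem_span_singleton.mpr ⟨_, rfl⟩, sub_add_cancel h _⟩
  · apply sup_le
    · intro r hr
      exact Submodule.mem_inf.mpr ⟨rad_le_inf_ker B N hz hr, rad_le_orthogonal_of_le B N _ inf_le_left hr⟩
    · rw [Submodule.span_singleton_le_iff_mem]
      exact Submodule.mem_inf.mpr ⟨hzH, hzorth⟩

/-- In R3 the vector `z` is not in the radical of `N`. [folklore] -/
theorem not_mem_rad_of_not_mem_orthogonal (N : Submodule K V) {z : V} (hzN : z ∉ B.orthogonal N) :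
    z ∉ N ⊓ B.orthogonal N := fun h => hzN (Submodule.mem_inf.mp h).2

omit B in
/-- `dim (R + Kz) = dim R + 1` for `z ∉ R`. [folklore] -/
theorem finrank_sup_span_singleton [FiniteDimensional K V] (R : Submodule K V) {z : V} (hz : z ∉ R) :
    Module.finrank K ↥(R ⊔ K ∙ z) = Module.finrank K R + 1 := by
  have hz0 : z ≠ 0 := fun h => hz (h ▸ R.zero_mem)
  have hdisj : Disjoint R (K ∙ z) := by
    rw [Submodule.disjoint_span_singleton' hz0]
    exact hz
  have h := Submodule.finrank_sup_add_finrank_inf_eq R (K ∙ z)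
  rw [hdisj.eq_bot, finrank_bot, add_zero, finrank_span_singleton hz0] at h
  exact h

end Restrict

end Summit.BirchSwinnertonDyer.Rank1Residual.P2.AokiMonsky
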